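import Literature.Analysis.FunctionSpaces.KMSStatesProofs
import Literature.MathematicalPhysics.QuantumLattice.CStarStateCompactProofs
import Literature.MathematicalPhysics.QuantumLattice.CStarStateConvexProofs
import HarnessLib

/-!
# KMS states: the set `K_β` is convex and weak-⋆ compact (Bratteli–Robinson II Thm. 5.3.30 (1))

Sibling proofs file of `Literature/Analysis/FunctionSpaces/KMSStates.lean` (trunk `AnalysisL`,
topic `Analysis/FunctionSpaces`). It discharges the two named facts of that file which make up
part (1) of Bratteli–Robinson II Thm. 5.3.30 — "the set `K_β` of `(τ, β)`-KMS states is a convex,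
weak\*-compact subset of the state space `E_𝔄`" (unital `𝔄`; quoted after Ha–Paugam,
*Bost–Connes–Marcolli systems for Shimura varieties I*, IMRP 2005, Prop. 11: "The set `𝓔_β` of
KMS-`β` states is a convex, weak\*-compact simplex", citing BR II Thm. 5.3.30) — for a strongly
continuous one-parameter group `τ` of ⋆-automorphisms of a unital C⋆-algebra `A` (with its
C⋆-order, `[StarOrderedRing A]`, so that `State A` is the state space) and an inverse temperature
`β > 0`:

* `Literature.isClosed_kmsStates_holds : isClosed_kmsStates` — `State.toWeakDual '' kmsStates τ β` is
  weak-⋆ closed;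
* `Literature.Analysis.FunctionSpaces.isCompact_kmsStates` — hence weak-⋆ compact (closed subset of the compact state space,
  `isCompact_stateSpace_holds`, Bratteli–Robinson I Thm. 2.3.15);
* `Literature.convex_kmsStates_holds : convex_kmsStates` — and convex.

Architecture of the printed proof and of this file. Bratteli–Robinson II *define* `(τ, β)`-KMS
states by the relations `ω(a τ_{iβ}(b)) = ω(b a)`, `a ∈ 𝔄`, `b` entire analytic (Def. 5.3.1), and
prove the equivalence with the strip form `F_{a,b}` (Prop. 5.3.7), which is the form vendored as
`State.IsKMSState`; the equivalence, for states of the C⋆-algebra, is proved in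
`KMSStatesProofs.lean` (`State.IsKMSState.apply_mul_entire`, `State.IsKMSState.of_entire`). In the
entire-element form each relation is a weak-⋆ closed condition on `ω` (evaluation `φ ↦ φ x` is
weak-⋆ continuous, `WeakDual.eval_continuous`), and the state space `E_A` is weak-⋆ closed
(`isClosed_stateSpace`) and equal to the range of `State.toWeakDual`
(`exists_state_toWeakDual_eq`, `CStarStateCompactProofs.lean`); so
`State.toWeakDual '' K_β = E_A ∩ ⋂_{a, b, F} {φ | φ(a F(iβ)) = φ(b a)}`
(`image_toWeakDual_kmsStates_eq`) is closed, and compact inside the compact `E_A`. Convexity is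
read off the strip form directly: `F_{a,b}` depends linearly on `ω`, so `s F¹_{a,b} + t F²_{a,b}`
is a strip function for `s ω₁ + t ω₂` (no continuity of `τ` needed, matching the binders of
`convex_kmsStates`, which carries only `0 < β`).

## Sources

* [BratteliRobinsonII1997] O. Bratteli, D. W. Robinson, *Operator Algebras and Quantum Statistical
  Mechanics 2*, 2nd ed., Springer (1997), Def. 5.3.1, Prop. 5.3.7, Thm. 5.3.30 (1).
* [BratteliRobinsonI1987] O. Bratteli, D. W. Robinson, *Operator Algebras and Quantum Statistical
  Mechanics 1*, 2nd ed., Springer (1987), Thm. 2.3.15 (state space weak-⋆ compact, unital case).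
* E. Ha, F. Paugam, *Bost–Connes–Marcolli systems for Shimura varieties. I*, IMRP 2005:5,
  237–286, Prop. 11 (p. 8 of arXiv:math/0507101), restating BR II Thm. 5.3.30.
-/

noncomputable section

open Complex Topology Set

namespace Literature.Analysis.FunctionSpaces

variable {A : Type*} [CStarAlgebra A] [PartialOrder A] [StarOrderedRing A]
  {τ : ℝ → (A ≃⋆ₐ[ℂ] A)} {β : ℝ}

/-- **KMS states are cut out of the state space by closed linear relations**: for a strongly
continuous automorphism group `τ` and `β > 0`, the weak-⋆ functionals of the `(τ, β)`-KMS states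
are exactly the points `φ` of the state space `E_A` with `φ(a F(iβ)) = φ(b a)` for all `a ∈ A` and
all entire analytic elements `b` (entire extension `F` of `t ↦ τ_t(b)`). This is
Bratteli–Robinson II Def. 5.3.1 of `K_β`, matched with the strip form through Prop. 5.3.7
(`State.isKMSState_iff_forall_entire`). [cite: BratteliRobinsonII1997, Prop. 5.3.7] -/
theorem image_toWeakDual_kmsStates_eq (hτ : Literature.MathematicalPhysics.QuantumLattice.IsAutomorphismGroup τ) (hβ : 0 < β) :
    Literature.MathematicalPhysics.QuantumLattice.State.toWeakDual '' kmsStates τ β =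
      Literature.MathematicalPhysics.QuantumLattice.stateSpace A ∩ ⋂ (a : A) (b : A) (F : ℂ → A) (_ : IsEntireElementFor τ b F),
        {φ : WeakDual ℂ A | φ (a * F (β * I)) = φ (b * a)} := by
  ext φ
  simp only [mem_image, mem_inter_iff, mem_iInter, mem_setOf_eq, mem_kmsStates]
  constructor
  · rintro ⟨ω, hω, rfl⟩
    exact ⟨ω.toWeakDual_mem_stateSpace, fun a b F hF => hω.apply_mul_entire hτ hβ a b F hF⟩
  · rintro ⟨hφ, h⟩
    obtain ⟨ω, rfl⟩ := Literature.MathematicalPhysics.QuantumLattice.exists_state_toWeakDual_eq hφ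
    exact ⟨ω, Literature.MathematicalPhysics.QuantumLattice.State.IsKMSState.of_entire hτ hβ fun a b F hF => h a b F hF, rfl⟩

/-- **Discharge of `isClosed_kmsStates` (Bratteli–Robinson II Thm. 5.3.30 (1), closedness).** For a
strongly continuous one-parameter group `τ` of ⋆-automorphisms of a unital C⋆-algebra `A` and
`β > 0`, the set `K_β` of `(τ, β)`-KMS states is weak-⋆ closed in `WeakDual ℂ A`: by
`image_toWeakDual_kmsStates_eq` it is the intersection of the closed state space
(`isClosed_stateSpace`) with the closed sets `{φ | φ(a F(iβ)) = φ(b a)}` (evaluation is weak-⋆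
continuous). [cite: BratteliRobinsonII1997, Thm. 5.3.30 (1)] -/
theorem isClosed_kmsStates_holds : isClosed_kmsStates (A := A) (τ := τ) (β := β) := by
  intro hτ hβ
  rw [image_toWeakDual_kmsStates_eq hτ hβ]
  exact Literature.MathematicalPhysics.QuantumLattice.isClosed_stateSpace.inter <| isClosed_iInter fun a => isClosed_iInter fun b =>
    isClosed_iInter fun F => isClosed_iInter fun _ =>
      isClosed_eq (WeakDual.eval_continuous _) (WeakDual.eval_continuous _)

/-- **The KMS states form a weak-⋆ compact set (Bratteli–Robinson II Thm. 5.3.30 (1)).** For a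
strongly continuous one-parameter group `τ` of ⋆-automorphisms of a unital C⋆-algebra `A` and
`β > 0`, `K_β ⊆ E_A` is weak-⋆ compact: a weak-⋆ closed subset (`isClosed_kmsStates_holds`) of the
weak-⋆ compact state space (`isCompact_stateSpace_holds`, Bratteli–Robinson I Thm. 2.3.15).
[cite: BratteliRobinsonII1997, Thm. 5.3.30 (1)] -/
theorem isCompact_kmsStates (hτ : Literature.MathematicalPhysics.QuantumLattice.IsAutomorphismGroup τ) (hβ : 0 < β) :
    IsCompact (Literature.MathematicalPhysics.QuantumLattice.State.toWeakDual '' kmsStates (A := A) τ β) :=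
  Literature.MathematicalPhysics.QuantumLattice.isCompact_stateSpace_holds.of_isClosed_subset (isClosed_kmsStates_holds hτ hβ)
    (by rintro _ ⟨ω, _, rfl⟩; exact ω.toWeakDual_mem_stateSpace)

/-- **Discharge of `convex_kmsStates` (Bratteli–Robinson II Thm. 5.3.30 (1), convexity).** The set
`K_β` of `(τ, β)`-KMS states is convex (over `ℝ`, in `WeakDual ℂ A`): a convex combination
`s ω₁ + t ω₂` of states is a state (`State.convexCombo_toWeakDual_mem_stateSpace`,
Bratteli–Robinson I Cor. 2.3.12), and `s F¹_{a,b} + t F²_{a,b}` is a KMS strip function for it,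
the strip form `State.IsKMSState` being linear in `ω`. [cite: BratteliRobinsonII1997, Thm. 5.3.30 (1)] -/
theorem convex_kmsStates_holds : convex_kmsStates (A := A) (τ := τ) (β := β) := by
  intro hβ
  rintro _ ⟨ω₁, h₁, rfl⟩ _ ⟨ω₂, h₂, rfl⟩ s t hs ht hst
  obtain ⟨ω, hω⟩ :=
    Literature.MathematicalPhysics.QuantumLattice.exists_state_toWeakDual_eq (Literature.MathematicalPhysics.QuantumLattice.State.convexCombo_toWeakDual_mem_stateSpace ω₁ ω₂ hs ht hst)
  refine ⟨ω, fun a b => ?_, hω⟩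
  have hωx : ∀ x : A, ω x = (s : ℂ) * ω₁ x + (t : ℂ) * ω₂ x := fun x => by
    have hx := congrArg (fun φ : WeakDual ℂ A => φ x) hω
    simp only [Literature.MathematicalPhysics.QuantumLattice.State.toWeakDual_apply] at hx
    rw [hx]
    change s • ω₁ x + t • ω₂ x = _
    rw [Complex.real_smul, Complex.real_smul]
  obtain ⟨F₁, hc₁, hd₁, ⟨C₁, hC₁⟩, h0₁, hβ₁⟩ := h₁ a b
  obtain ⟨F₂, hc₂, hd₂, ⟨C₂, hC₂⟩, h0₂, hβ₂⟩ := h₂ a b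
  refine ⟨fun z => (s : ℂ) * F₁ z + (t : ℂ) * F₂ z, ?_, ?_, ⟨s * C₁ + t * C₂, fun z hz => ?_⟩,
    fun u => ?_, fun u => ?_⟩
  · exact (continuousOn_const.mul hc₁).add (continuousOn_const.mul hc₂)
  · exact ((differentiableOn_const _).mul hd₁).add ((differentiableOn_const _).mul hd₂)
  · refine (norm_add_le _ _).trans ?_
    rw [norm_mul, norm_mul, Complex.norm_real, Complex.norm_real, Real.norm_of_nonneg hs,
      Real.norm_of_nonneg ht]
    gcongr
    exacts [hC₁ z hz, hC₂ z hz]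
  · simp only [hωx, h0₁, h0₂]
  · simp only [hωx, hβ₁, hβ₂]

end Literature.Analysis.FunctionSpaces
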